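import Literature.NumberTheory.Irrationality.PAdicZetaValues.Criterion
import Mathlib.Analysis.SpecialFunctions.Pow.Real
import Mathlib.Analysis.SpecialFunctions.Log.Basic
import HarnessLib

/-!
# Bel's `p`-adic irrationality-measure criterion (Lai–Sprang–Zudilin 2026, Lemma 2.3) — PROVED

Topic `Literature/NumberTheory/Irrationality/PAdicZetaValues`. PROOF FILE (sorry-free theorems only; no definition, no named
fact; net debt 0): the criterion through which [LaiSprangZudilin2026, Thm 1.1] (`ζ_2(5) ∉ ℚ`, `μ(ζ_2(5)) ≤ 16 log 2/(8 log 2 − 5)`;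
tree `Records.laiSprangZudilin2026_theorem11`) is obtained:

[LaiSprangZudilin2026, Lemma 2.3 (Bel [Bel2019])], verbatim: "Let `p` be a prime, `ξ ∈ ℚ_p` and `α, β` two real numbers
satisfying `α > β > 0`. Suppose that there exist two sequences `(a_n)_{n≥1} ⊂ ℤ` and `(b_n)_{n≥1} ⊂ ℤ` such that
• `|a_n + b_n ξ|_p ≤ exp(−αn + o(n))` as `n → ∞`; • `max{|a_n|, |b_n|} ≤ exp(βn + o(n))` as `n → ∞`;
• `a_n b_{n+1} − a_{n+1} b_n ≠ 0` for any `n ∈ ℤ_{>0}`. Then the `p`-adic number `ξ` is irrational, with the following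
estimate for its irrationality measure: `μ(ξ) ≤ α/(α − β)`." (`μ` as in their Definition 2.2 = `IrrationalityExponentLE`.)

The two `o(n)`'s are rendered (equivalently) as: for every `ε > 0`, eventually `|a_n + b_n ξ|_p ≤ e^{−(α−ε)n}` and
`max{|a_n|, |b_n|} ≤ e^{(β+ε)n}`.

PROOF (the classical one): for `A/B ∈ ℚ` put `N_n = a_n B + b_n A ∈ ℤ`; the determinant condition forces `N_n ≠ 0` or
`N_{n+1} ≠ 0` (`ne_zero_or_ne_zero_of_det_ne_zero`); for such an index `1/(2 M_n H) ≤ |N_n|_p ≤ max(|a_n + b_n ξ|_p,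
|ξ − A/B|_p)` with `M_n = max(|a_n|, |b_n|)`, `H = max(|A|, |B|)` (`key_lower_bound`, from `1/|N| ≤ |N|_p` of
`Criterion.lean`); choosing `n ≈ log(2H)/(α − β − 2ε)` makes `|a_n + b_n ξ|_p` too small, whence
`|ξ − A/B|_p ≥ c(ε) · (2H)^{−1 − (β+ε)/(α−β−2ε)}` for all `A/B` (`lower_bound`), which gives both `ξ ∉ ℚ` and
`μ(ξ) ≤ α/(α − β)` (letting `ε → 0`).
-/

noncomputable section

open Filter Finset
open scoped Topology

namespace Literature.NumberTheory.Irrationality.PAdicZetaValues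

namespace MeasureCriterion

variable (p : ℕ) [Fact p.Prime]

/-- If `a B + b A = 0` and `a' B + b' A = 0` with `B ≠ 0` then `a b' − a' b = 0`. [cite: LaiSprangZudilin2026, Lemma 2.3 (third condition)] -/
theorem det_eq_zero_of {a b a' b' A B : ℤ} (hB : B ≠ 0) (h1 : a * B + b * A = 0) (h2 : a' * B + b' * A = 0) :
    a * b' - a' * b = 0 := by
  have : B * (a * b' - a' * b) = 0 := by linear_combination b' * h1 - b * h2
  rcases mul_eq_zero.mp this with h | h
  · exact absurd h hB
  · exact h

/-- **Key lower bound.** For integers `a, b, A, B` with `B > 0` and `N = aB + bA ≠ 0`, and `ξ ∈ ℚ_p`: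
`1/(2 max(|a|,|b|) max(|A|,|B|)) ≤ max(|a + bξ|_p, |ξ − A/B|_p)`. [cite: LaiSprangZudilin2026, Lemma 2.3 (proof)] -/
theorem key_lower_bound (ξ : ℚ_[p]) {a b A B : ℤ} (hB : 0 < B) (hN : a * B + b * A ≠ 0) :
    1 / (2 * max (|a| : ℝ) |b| * max (|A| : ℝ) |B|) ≤
      max ‖(a : ℚ_[p]) + b * ξ‖ ‖ξ - (A : ℚ_[p]) / (B : ℚ_[p])‖ := by
  set N : ℤ := a * B + b * A with hNdef
  set M : ℝ := max (|a| : ℝ) |b| with hM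
  set H : ℝ := max (|A| : ℝ) |B| with hH
  have hB1 : (1 : ℤ) ≤ B := by omega
  have hH1 : (1 : ℝ) ≤ H :=
    le_trans (le_trans (by exact_mod_cast hB1) (le_abs_self (B : ℝ))) (le_max_right _ _)
  have hB0 : (B : ℚ_[p]) ≠ 0 := by exact_mod_cast hB.ne'
  -- `1/|N| ≤ |N|_p`
  have h1 : 1 / |(N : ℝ)| ≤ ‖(N : ℚ_[p])‖ := one_div_abs_le_norm_intCast p hN
  -- `|N| ≤ 2 M H`
  have h2 : |(N : ℝ)| ≤ 2 * M * H := by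
    have : (N : ℝ) = a * B + b * A := by rw [hNdef]; push_cast; ring
    rw [this]
    calc |(a : ℝ) * B + b * A| ≤ |(a : ℝ) * B| + |(b : ℝ) * A| := abs_add_le _ _
      _ = |(a : ℝ)| * |(B : ℝ)| + |(b : ℝ)| * |(A : ℝ)| := by rw [abs_mul, abs_mul]
      _ ≤ M * H + M * H := by
          gcongr
          · exact le_max_left _ _
          · exact le_max_right _ _
          · exact le_max_right _ _
          · exact le_max_left _ _
      _ = 2 * M * H := by ring
  have hNpos : (0 : ℝ) < |(N : ℝ)| := by exact_mod_cast abs_pos.mpr hN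
  have hMH : (0 : ℝ) < 2 * M * H := lt_of_lt_of_le hNpos h2
  -- `|N|_p ≤ max(|a + bξ|_p, |ξ − A/B|_p)`
  have h3 : ‖(N : ℚ_[p])‖ ≤ max ‖(a : ℚ_[p]) + b * ξ‖ ‖ξ - (A : ℚ_[p]) / (B : ℚ_[p])‖ := by
    have hNeq : (N : ℚ_[p]) = (B : ℚ_[p]) * (((a : ℚ_[p]) + b * ξ) + b * ((A : ℚ_[p]) / B - ξ)) := by
      rw [hNdef]; push_cast; field_simp; ring
    rw [hNeq, norm_mul]
    have hBle : ‖(B : ℚ_[p])‖ ≤ 1 := Padic.norm_int_le_one B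
    have hb1 : ‖(b : ℚ_[p])‖ ≤ 1 := Padic.norm_int_le_one b
    calc ‖(B : ℚ_[p])‖ * ‖((a : ℚ_[p]) + b * ξ) + b * ((A : ℚ_[p]) / B - ξ)‖
        ≤ 1 * ‖((a : ℚ_[p]) + b * ξ) + b * ((A : ℚ_[p]) / B - ξ)‖ := by gcongr
      _ ≤ max ‖(a : ℚ_[p]) + b * ξ‖ ‖(b : ℚ_[p]) * ((A : ℚ_[p]) / B - ξ)‖ := by
          rw [one_mul]; exact Padic.nonarchimedean _ _
      _ ≤ max ‖(a : ℚ_[p]) + b * ξ‖ ‖ξ - (A : ℚ_[p]) / (B : ℚ_[p])‖ := by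
          apply max_le_max le_rfl
          rw [norm_mul, ← norm_neg (ξ - _), neg_sub]
          calc ‖(b : ℚ_[p])‖ * ‖(A : ℚ_[p]) / B - ξ‖ ≤ 1 * ‖(A : ℚ_[p]) / B - ξ‖ := by gcongr
            _ = ‖(A : ℚ_[p]) / B - ξ‖ := one_mul _
  calc 1 / (2 * M * H) ≤ 1 / |(N : ℝ)| := one_div_le_one_div_of_le hNpos h2
    _ ≤ ‖(N : ℚ_[p])‖ := h1
    _ ≤ _ := h3

/-- **Uniform lower bound for `|ξ − A/B|_p`.** Under the two growth hypotheses and the determinant condition, for every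
`ε > 0` with `2ε < α − β` there are `N₁` and the exponent `λ = 1 + (β+ε)/(α−β−2ε)` such that for all `A ∈ ℤ`, `B ≥ 1`,
`|ξ − A/B|_p ≥ e^{−(β+ε)(N₁+3)} · e^{−λ log(2 max(|A|,|B|))}`. [cite: LaiSprangZudilin2026, Lemma 2.3 (proof)] -/
theorem lower_bound (ξ : ℚ_[p]) {α β : ℝ} (a b : ℕ → ℤ)
    (h1 : ∀ ε : ℝ, 0 < ε → ∀ᶠ n : ℕ in atTop, ‖(a n : ℚ_[p]) + b n * ξ‖ ≤ Real.exp (-(α - ε) * n))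
    (h2 : ∀ ε : ℝ, 0 < ε → ∀ᶠ n : ℕ in atTop, max (|a n| : ℝ) |b n| ≤ Real.exp ((β + ε) * n))
    (h3 : ∀ n, a n * b (n + 1) - a (n + 1) * b n ≠ 0)
    {ε : ℝ} (hε : 0 < ε) (hε2 : 2 * ε < α - β) (hβε : 0 ≤ β + ε) :
    ∃ N₁ : ℕ, ∀ A B : ℤ, 0 < B →
      Real.exp (-(β + ε) * (N₁ + 3)) *
          Real.exp (-(1 + (β + ε) / (α - β - 2 * ε)) * Real.log (2 * max (|A| : ℝ) |B|)) ≤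
        ‖ξ - (A : ℚ_[p]) / (B : ℚ_[p])‖ := by
  obtain ⟨N₁, hN₁⟩ := eventually_atTop.mp ((h1 ε hε).and (h2 ε hε))
  refine ⟨N₁, fun A B hB => ?_⟩
  set κ' : ℝ := α - β - 2 * ε with hκ'
  have hκ'0 : 0 < κ' := by rw [hκ']; linarith
  set H : ℝ := max (|A| : ℝ) |B| with hH
  have hB1 : (1 : ℤ) ≤ B := by omega
  have hH1 : (1 : ℝ) ≤ H :=
    le_trans (le_trans (by exact_mod_cast hB1) (le_abs_self (B : ℝ))) (le_max_right _ _)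
  have hH0 : (0 : ℝ) < H := by linarith
  have h2H : (1 : ℝ) < 2 * H := by linarith
  have hlog0 : 0 < Real.log (2 * H) := Real.log_pos h2H
  set T : ℝ := Real.log (2 * H) / κ' with hT
  have hT0 : 0 ≤ T := div_nonneg hlog0.le hκ'0.le
  -- the index `n = N₁ + ⌈T⌉₊ + 1`
  set n : ℕ := N₁ + ⌈T⌉₊ + 1 with hn
  have hnN : N₁ ≤ n := by omega
  have hnT : T < n := by
    have := Nat.le_ceil T
    have h' : (n : ℝ) = N₁ + ⌈T⌉₊ + 1 := by rw [hn]; push_cast; ring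
    rw [h']; linarith [(Nat.cast_nonneg N₁ : (0 : ℝ) ≤ N₁)]
  have hn1 : (n : ℝ) + 1 ≤ N₁ + T + 3 := by
    have := Nat.ceil_lt_add_one hT0
    have h' : (n : ℝ) = N₁ + ⌈T⌉₊ + 1 := by rw [hn]; push_cast; ring
    rw [h']; linarith
  -- for `m ∈ {n, n+1}` with `N_m ≠ 0`: `|ξ − A/B| ≥ exp(−(β+ε) m)/(2H)`
  have step : ∀ m : ℕ, N₁ ≤ m → T < m → a m * B + b m * A ≠ 0 →
      Real.exp (-(β + ε) * m) / (2 * H) ≤ ‖ξ - (A : ℚ_[p]) / (B : ℚ_[p])‖ := by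
    intro m hm hTm hNm
    obtain ⟨hL, hM⟩ := hN₁ m hm
    have key := key_lower_bound p ξ hB hNm
    have hMpos : (0 : ℝ) < max (|a m| : ℝ) |b m| := by
      rcases lt_or_ge 0 (max (|a m| : ℝ) |b m|) with h | h
      · exact h
      · exfalso
        have ha : a m = 0 := by
          have := le_trans (le_max_left _ _) h; exact abs_nonpos_iff.mp (by exact_mod_cast this)
        have hb : b m = 0 := by
          have := le_trans (le_max_right _ _) h; exact abs_nonpos_iff.mp (by exact_mod_cast this)
        exact hNm (by rw [ha, hb]; ring)
    -- `exp(−(β+ε)m)/(2H) ≤ 1/(2 M H)`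
    have hlow : Real.exp (-(β + ε) * m) / (2 * H) ≤ 1 / (2 * max (|a m| : ℝ) |b m| * H) := by
      rw [div_le_div_iff₀ (by positivity) (mul_pos (mul_pos two_pos hMpos) hH0)]
      have : Real.exp (-(β + ε) * m) * max (|a m| : ℝ) |b m| ≤ 1 := by
        calc Real.exp (-(β + ε) * m) * max (|a m| : ℝ) |b m|
            ≤ Real.exp (-(β + ε) * m) * Real.exp ((β + ε) * m) := by gcongr
          _ = 1 := by
              rw [← Real.exp_add, show -(β + ε) * (m : ℝ) + (β + ε) * m = 0 by ring, Real.exp_zero]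
      calc Real.exp (-(β + ε) * m) * (2 * max (|a m| : ℝ) |b m| * H)
          = (Real.exp (-(β + ε) * m) * max (|a m| : ℝ) |b m|) * (2 * H) := by ring
        _ ≤ 1 * (2 * H) := by gcongr
    -- `|L_m| < exp(−(β+ε)m)/(2H)`: from `exp(κ' m) > 2H`
    have hsmall : ‖(a m : ℚ_[p]) + b m * ξ‖ < Real.exp (-(β + ε) * m) / (2 * H) := by
      have hκm : Real.log (2 * H) < κ' * m := by
        have := (div_lt_iff₀ hκ'0).mp (show Real.log (2 * H) / κ' < m from hTm)
        linarith
      have h2Hlt : 2 * H < Real.exp (κ' * m) := by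
        calc 2 * H = Real.exp (Real.log (2 * H)) := (Real.exp_log (by linarith)).symm
          _ < Real.exp (κ' * m) := Real.exp_lt_exp.mpr hκm
      calc ‖(a m : ℚ_[p]) + b m * ξ‖ ≤ Real.exp (-(α - ε) * m) := hL
        _ = Real.exp (-(β + ε) * m) / Real.exp (κ' * m) := by
            rw [eq_div_iff (Real.exp_pos _).ne', ← Real.exp_add, hκ']; ring_nf
        _ < Real.exp (-(β + ε) * m) / (2 * H) := by
            apply div_lt_div_of_pos_left (Real.exp_pos _) (by positivity) h2Hlt
    -- conclude from `key`
    rcases le_max_iff.mp key with h | h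
    · exact absurd (lt_of_le_of_lt h (lt_of_lt_of_le hsmall hlow)) (lt_irrefl _)
    · exact hlow.trans h
  -- one of `N_n`, `N_{n+1}` is nonzero
  have hor : a n * B + b n * A ≠ 0 ∨ a (n + 1) * B + b (n + 1) * A ≠ 0 := by
    by_contra hcon
    push Not at hcon
    exact h3 n (det_eq_zero_of hB.ne' hcon.1 hcon.2)
  have hfin : Real.exp (-(β + ε) * ((n : ℝ) + 1)) / (2 * H) ≤ ‖ξ - (A : ℚ_[p]) / (B : ℚ_[p])‖ := by
    rcases hor with h | h
    · refine le_trans ?_ (step n hnN hnT h)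
      apply div_le_div_of_nonneg_right _ (by linarith : (0 : ℝ) ≤ 2 * H)
      exact Real.exp_le_exp.mpr (by nlinarith [hβε])
    · have hT' : T < ((n + 1 : ℕ) : ℝ) := by push_cast; linarith
      have := step (n + 1) (by omega) hT' h
      simpa using this
  -- bookkeeping: `exp(−(β+ε)(N₁+3)) · exp(−λ log(2H)) ≤ exp(−(β+ε)(n+1))/(2H)`
  refine le_trans ?_ hfin
  have h2Hpos : (0 : ℝ) < 2 * H := by linarith
  have hR : Real.exp (-(β + ε) * ((n : ℝ) + 1)) / (2 * H) =
      Real.exp (-(β + ε) * ((n : ℝ) + 1) - Real.log (2 * H)) := by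
    rw [Real.exp_sub, Real.exp_log h2Hpos]
  rw [hR, ← Real.exp_add]
  apply Real.exp_le_exp.mpr
  have hprod : (β + ε) * ((n : ℝ) + 1) ≤ (β + ε) * (N₁ + T + 3) := mul_le_mul_of_nonneg_left hn1 hβε
  have hTdef : (β + ε) / κ' * Real.log (2 * H) = (β + ε) * T := by
    rw [hT]; field_simp
  linarith [hprod, hTdef]

/-- **Bel's criterion** [LaiSprangZudilin2026, Lemma 2.3 (Bel 2019)] (PROVED): `ξ ∈ ℚ_p`, `α > β > 0`, integer sequences
`a_n, b_n` with `|a_n + b_n ξ|_p ≤ e^{−αn + o(n)}`, `max(|a_n|, |b_n|) ≤ e^{βn + o(n)}` and `a_n b_{n+1} − a_{n+1} b_n ≠ 0`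
for all `n` ⟹ `ξ` is irrational and `μ(ξ) ≤ α/(α − β)` (the `o(n)`'s as `∀ ε > 0`, eventually `≤ e^{−(α−ε)n}`, resp.
`≤ e^{(β+ε)n}`; `μ` = `IrrationalityExponentLE`, [LaiSprangZudilin2026, Def. 2.2]). [cite: LaiSprangZudilin2026, Lemma 2.3] -/
theorem bel_criterion (ξ : ℚ_[p]) {α β : ℝ} (hβ : 0 < β) (hαβ : β < α) (a b : ℕ → ℤ)
    (h1 : ∀ ε : ℝ, 0 < ε → ∀ᶠ n : ℕ in atTop, ‖(a n : ℚ_[p]) + b n * ξ‖ ≤ Real.exp (-(α - ε) * n))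
    (h2 : ∀ ε : ℝ, 0 < ε → ∀ᶠ n : ℕ in atTop, max (|a n| : ℝ) |b n| ≤ Real.exp ((β + ε) * n))
    (h3 : ∀ n, a n * b (n + 1) - a (n + 1) * b n ≠ 0) :
    IsIrrational p ξ ∧ IrrationalityExponentLE p ξ (α / (α - β)) := by
  have hκ : 0 < α - β := by linarith
  constructor
  · -- irrationality
    rw [isIrrational_iff]
    intro q hq
    obtain ⟨N₁, hN₁⟩ := lower_bound p ξ a b h1 h2 h3 (ε := (α - β) / 4) (by linarith) (by linarith) (by linarith)
    have hden : (0 : ℤ) < q.den := by exact_mod_cast q.den_pos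
    have h := hN₁ q.num q.den hden
    have h0 : ξ - (q.num : ℚ_[p]) / ((q.den : ℤ) : ℚ_[p]) = 0 := by
      rw [← hq, sub_eq_zero, Rat.cast_def]
      push_cast
      rfl
    rw [h0, norm_zero] at h
    exact absurd h (not_le.mpr (by positivity))
  · -- the measure
    intro μ hμ
    set m : ℝ := μ - 1 with hmdef
    have hαfrac : α / (α - β) = 1 + β / (α - β) := by field_simp; ring
    have hm : β / (α - β) < m := by rw [hmdef]; linarith [hαfrac ▸ hμ]
    have hmκ : 0 < m * (α - β) - β := by
      have := (div_lt_iff₀ hκ).mp hm; linarith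
    have hm0 : 0 < m := lt_trans (div_pos hβ hκ) hm
    set ε : ℝ := min ((α - β) / 4) ((m * (α - β) - β) / (2 * (1 + 2 * m))) with hεdef
    have hε : 0 < ε := lt_min (by linarith) (div_pos hmκ (by linarith))
    have hε4 : ε ≤ (α - β) / 4 := min_le_left _ _
    have hε2 : 2 * ε < α - β := by linarith
    have hk : 0 < α - β - 2 * ε := by linarith
    have hεm : ε * (1 + 2 * m) < m * (α - β) - β := by
      have hle : ε ≤ (m * (α - β) - β) / (2 * (1 + 2 * m)) := min_le_right _ _
      have := (le_div_iff₀ (by linarith : (0 : ℝ) < 2 * (1 + 2 * m))).mp hle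
      nlinarith
    set lam : ℝ := 1 + (β + ε) / (α - β - 2 * ε) with hlamdef
    have hlamμ : lam < μ := by
      have : (β + ε) / (α - β - 2 * ε) < m := by
        rw [div_lt_iff₀ hk]; nlinarith
      rw [hlamdef, hmdef] at *; linarith
    obtain ⟨N₁, hN₁⟩ := lower_bound p ξ a b h1 h2 h3 hε hε2 (by linarith)
    -- the constant `c = e^{−(β+ε)(N₁+3)} · e^{−λ log 2}` and the height bound `exp(log(1/c)/(μ−λ))`
    set c : ℝ := Real.exp (-(β + ε) * (N₁ + 3)) * Real.exp (-lam * Real.log 2) with hcdef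
    have hc : 0 < c := by positivity
    set K : ℕ := ⌈Real.exp (Real.log (1 / c) / (μ - lam))⌉₊ with hKdef
    refine Set.Finite.subset ((Set.finite_Icc (-(K : ℤ)) K).prod (Set.finite_Icc (-(K : ℤ)) K)) ?_
    rintro ⟨A, B⟩ ⟨hB, hpos, hlt⟩
    simp only at hB hpos hlt
    -- real height
    set H : ℝ := max (|A| : ℝ) |B| with hH
    have hH1 : (1 : ℝ) ≤ H := le_trans (by exact_mod_cast hB) ((le_abs_self (B : ℝ)).trans (le_max_right _ _))
    have hH0 : (0 : ℝ) < H := by linarith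
    have hcast : (((max |A| |B| : ℤ)) : ℝ) = H := by rw [hH]; push_cast; rfl
    rw [hcast, Real.rpow_def_of_pos hH0] at hlt
    -- lower bound at (A, B)
    have hlow := hN₁ A B hB
    rw [← hH, ← hlamdef] at hlow
    have hlow' : c * Real.exp (-lam * Real.log H) ≤ ‖ξ - (A : ℚ_[p]) / (B : ℚ_[p])‖ := by
      have hsplit : Real.exp (-lam * Real.log (2 * H)) =
          Real.exp (-lam * Real.log 2) * Real.exp (-lam * Real.log H) := by
        rw [← Real.exp_add, Real.log_mul (by norm_num) hH0.ne']
        ring_nf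
      calc c * Real.exp (-lam * Real.log H)
          = Real.exp (-(β + ε) * (N₁ + 3)) * (Real.exp (-lam * Real.log 2) * Real.exp (-lam * Real.log H)) := by
            rw [hcdef]; ring
        _ = Real.exp (-(β + ε) * (N₁ + 3)) * Real.exp (-lam * Real.log (2 * H)) := by rw [hsplit]
        _ ≤ _ := hlow
    -- combine: `c · e^{−λ log H} < e^{−μ log H}` ⇒ `log H < log(1/c)/(μ−λ)`
    have hcomb : c * Real.exp (-lam * Real.log H) < Real.exp (-(Real.log H * μ)) := by
      have := lt_of_le_of_lt hlow' hlt
      rwa [one_div, ← Real.exp_neg] at this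
    have hlogH : Real.log H < Real.log (1 / c) / (μ - lam) := by
      have hμl : 0 < μ - lam := by linarith
      rw [lt_div_iff₀ hμl]
      -- from hcomb: c < exp(−μ log H + λ log H)
      have h' : c < Real.exp (-(μ - lam) * Real.log H) := by
        have := (lt_div_iff₀ (Real.exp_pos (-lam * Real.log H))).mpr hcomb
        rw [← Real.exp_sub] at this
        have heq : -(Real.log H * μ) - -lam * Real.log H = -(μ - lam) * Real.log H := by ring
        rwa [heq] at this
      have h'' := Real.log_lt_log hc h'
      rw [Real.log_exp] at h''
      rw [one_div, Real.log_inv]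
      nlinarith
    have hHlt : H < Real.exp (Real.log (1 / c) / (μ - lam)) := by
      calc H = Real.exp (Real.log H) := (Real.exp_log hH0).symm
        _ < _ := Real.exp_lt_exp.mpr hlogH
    have hHK : H ≤ K := le_trans hHlt.le (Nat.le_ceil _)
    have hA : |(A : ℝ)| ≤ K := le_trans (le_max_left _ _) hHK
    have hB' : |(B : ℝ)| ≤ K := le_trans (le_max_right _ _) hHK
    have hA' : |A| ≤ (K : ℤ) := by exact_mod_cast hA
    have hB'' : |B| ≤ (K : ℤ) := by exact_mod_cast hB'
    exact ⟨⟨by linarith [neg_abs_le A], (le_abs_self A).trans hA'⟩,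
      ⟨by linarith [neg_abs_le B], (le_abs_self B).trans hB''⟩⟩

end MeasureCriterion

end Literature.NumberTheory.Irrationality.PAdicZetaValues
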